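import Summits.Ventures.HodgeRepro2.T7SupportDominantTermPolynomialNonzero

/-!
# A two-period trace identity with an INFINITE geometric side dominated by one term (support, seat p1)

The shadow of a relative trace formula whose geometric side is an infinite absolutely convergent sum over
«double cosets» `γ : Orb` (the shape forced by integrable archimedean test functions), with one distinguished
term `γ₀` dominating the rest at deep level: `orb N γ = a γ * b N γ` with polynomial decay of the archimedean
factor `a` in a size, a polynomial count of the double cosets of bounded size carrying weight, a size threshold
on the double cosets `≠ γ₀` carrying weight at level `N` growing with `N`, and `a γ₀ ≠ 0`, `b N γ₀ ≠ 0` for `N`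
large. The spectral side is a `∑'` over labels `π` whose term vanishes when either period predicate fails.
CONCLUSION (`DominantSide.exists_twoTorus`, sorry-free over the shadow): some `π` has both periods.

The fields are the displayed ANALYTIC facts of such an argument; nothing here is about any group, torus, test
function, or period — the bookkeeping «geometric side ≠ 0 for some level ⇒ a spectral term ≠ 0 ⇒ both periods»
with the geometric side's non-vanishing supplied by the dominant-term estimate (`T7SupportDominantTermPolynomial`).
Blind lane: Mathlib + the HodgeRepro2 prefix only; no sorry; axioms ⊆ {propext, Classical.choice, Quot.sound}.
-/

namespace Summit.Ventures.HodgeRepro2.T7SupportDominantGeometricSide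

open Filter Topology T7SupportDominantTermPolynomialNonzero

/-- The shadow: an infinite geometric side with a dominant term, and a spectral side over labels. -/
structure DominantSide (Rep Orb : Type) [DecidableEq Orb] (PA PB : Rep → Prop) where
  /-- the spectral term of level `N` at `π` -/
  spec : ℕ → Rep → ℂ
  /-- the spectral term vanishes when the first period vanishes -/
  spec_zero_A : ∀ N π, ¬ PA π → spec N π = 0
  /-- the spectral term vanishes when the second period vanishes -/
  spec_zero_B : ∀ N π, ¬ PB π → spec N π = 0
  /-- the archimedean factor of the orbital weight (independent of the level) -/
  a : Orb → ℂ
  /-- the finite-place factor of the orbital weight at level `N` -/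
  b : ℕ → Orb → ℂ
  /-- the orbital weight `orb N γ = a γ * b N γ` -/
  orb : ℕ → Orb → ℂ
  orb_eq : ∀ N γ, orb N γ = a γ * b N γ
  /-- the geometric side converges absolutely at every level -/
  abs_summable : ∀ N, Summable fun γ => ‖orb N γ‖
  /-- THE TRACE IDENTITY: geometric side = spectral side -/
  identity : ∀ N, ∑' γ, orb N γ = ∑' π, spec N π
  /-- the distinguished double coset -/
  γ₀ : Orb
  /-- the size of a double coset (an archimedean invariant) -/
  size : Orb → ℝ
  size_nonneg : ∀ γ, 0 ≤ size γ
  /-- «`γ` meets the support of the level-`N` finite test function» -/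
  arith : ℕ → Orb → Prop
  b_support : ∀ N γ, b N γ ≠ 0 → arith N γ
  /-- the decay exponent of the archimedean factor, the growth exponents of the count and of the finite factor -/
  α : ℝ
  β : ℝ
  d' : ℝ
  hβ : 0 ≤ β
  hd' : 0 ≤ d'
  /-- the exponent condition: decay beats count × growth -/
  hαβ : β + d' < α
  /-- polynomial decay of the archimedean factor in the size -/
  a_bound : ∃ C : ℝ, ∀ γ, ‖a γ‖ ≤ C * (1 + size γ) ^ (-α)
  /-- the size threshold at level `N` -/
  ρ : ℕ → ℝ
  hρ : Tendsto ρ atTop atTop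
  /-- a double coset `≠ γ₀` carrying weight at level `N` has size `≥ ρ N` -/
  size_of_arith : ∀ N γ, arith N γ → γ ≠ γ₀ → ρ N ≤ size γ
  /-- polynomial count of the double cosets of bounded size carrying weight, uniformly in the level -/
  count_bound : ∃ C' : ℝ, ∀ N (R : ℝ), 0 ≤ R →
    ∃ s : Finset Orb, (∀ γ, arith N γ → size γ ≤ R → γ ∈ s) ∧ (s.card : ℝ) ≤ C' * (1 + R) ^ β
  /-- the finite factor of a double coset carrying weight is at most polynomially larger than that of `γ₀` -/
  b_bound : ∃ B : ℝ, ∀ N γ, arith N γ → ‖b N γ‖ ≤ B * (1 + size γ) ^ d' * ‖b N γ₀‖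
  /-- the distinguished term: both factors non-zero (for `N` large) -/
  a_γ₀ : a γ₀ ≠ 0
  b_γ₀ : ∃ N₀ : ℕ, ∀ N ≥ N₀, b N γ₀ ≠ 0

namespace DominantSide

variable {Rep Orb : Type} [DecidableEq Orb] {PA PB : Rep → Prop}

/-- the geometric side is non-zero at some level (the dominant-term argument) -/
theorem exists_geom_ne_zero (sh : DominantSide Rep Orb PA PB) : ∃ N, ∑' γ, sh.orb N γ ≠ 0 :=
  exists_tsum_ne_zero_of_polynomial sh.γ₀ sh.size sh.arith sh.a sh.b sh.orb sh.orb_eq sh.size_nonneg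
    sh.b_support sh.α sh.β sh.d' sh.hβ sh.hd' sh.hαβ sh.a_bound sh.ρ sh.hρ sh.size_of_arith
    sh.count_bound sh.b_bound sh.a_γ₀ sh.abs_summable sh.b_γ₀

/-- hence the spectral side is non-zero at that level, hence some spectral term is -/
theorem exists_spec_ne_zero (sh : DominantSide Rep Orb PA PB) : ∃ N π, sh.spec N π ≠ 0 := by
  obtain ⟨N, hN⟩ := sh.exists_geom_ne_zero
  rw [sh.identity N] at hN
  by_contra hall
  have h0 : sh.spec N = 0 := funext (fun π => by
    by_contra hπ
    exact hall ⟨N, π, hπ⟩)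
  exact hN (by rw [h0]; exact tsum_zero)

/-- **THE TWO-PERIOD CONCLUSION** (sorry-free over the shadow): some `π` has both periods. -/
theorem exists_twoTorus (sh : DominantSide Rep Orb PA PB) : ∃ π, PA π ∧ PB π := by
  obtain ⟨N, π, hπ⟩ := sh.exists_spec_ne_zero
  refine ⟨π, ?_, ?_⟩
  · by_contra h; exact hπ (sh.spec_zero_A N π h)
  · by_contra h; exact hπ (sh.spec_zero_B N π h)

end DominantSide

end Summit.Ventures.HodgeRepro2.T7SupportDominantGeometricSide
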